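import Mathlib
import HarnessLib
import Summits.Langlands.Statement
import Summits.Langlands.Langlands.Theses.SymmetricPowerAnchorSplit
import Summits.Langlands.Langlands.Theorems.MonodromyDichotomySymmetricPowerAnchor
import Literature.NumberTheory.Automorphic.ACCAutomorphyLiftingCrystalline
import Literature.NumberTheory.Automorphic.Sweep1SymmetricPower
import Literature.NumberTheory.GaloisRepresentations.IntegralGaloisActionProofs

/-!
# SeedReachNode — lens-3 gen 15 node of the decomp-langlands cell (RESIDUAL MODE); child route `SeedReachSplit`

TARGET = FC `Summit.Langlands.Langlands.Theses.SymmetricPowerAnchorSplit.CMSymmetricPowerAutomorphy` stmt-Langlands-28219 (crux r3, OPEN,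
never split; the named-open-problem crux of route-Langlands-SymmetricPowerAnchorSplit rev 1 = the lens-3 g14 child of MonodromyDichotomy at
SYM 31221; host items RES 28218 (declared residual) · FC 28219 · LS 28220 · FT 28221 · CSD 31695 · T′ 28350 · FRAME′ 28351).  FC says: over a CM
field K₀, n ≥ 6, rank-IH below n, for an irreducible pinned-geometric Lie-irreducible σ₀ : Γ_{K₀} → GL₂(ℚ̄_ℓ) with a COHOMOLOGICAL automorphic
partner π₀ (cuspidal on GL₂/K₀, regular L-algebraic infinity type, a.e. Satake–Frobenius compatible), every irreducible pinned-geometric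
Lie-irreducible `Sym^{n-1}`-SHADOW ρ₀ of σ₀ (charpoly ρ₀(g) = ∏_j (X − a^{n−1} r^j) when charpoly σ₀(g) = (X − a)(X − ar)) is weakly automorphic
on GL_n/K₀.  In print this is «Sym^{n−1} functoriality for cohomological π₀ on GL₂ over a CM field, n ≥ 6» — open (Newton–Thorne is totally real;
ACC+ §7 gives only POTENTIAL automorphy of Sym^m).

## 1. The ONE translation (lens-3 EQUIV): AVATAR ELIMINATION, certified `fc_iff_spf`

    fc_of_spf : SymPowerFunctoriality → CMSymmetricPowerAutomorphy                      (OUTRIGHT — the direction `closes` uses)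
    spf_of_fc : SymPowerAvatarExists → CMSymmetricPowerAutomorphy → SymPowerFunctoriality   (modulo the print antecedent AVX)

Second language = the AUTOMORPHIC side: SPF quantifies over σ₀ and its partner only and concludes `IsSymWeaklyAutomorphic` — an L-algebraic
cuspidal P on GL_n/K₀ whose Satake parameter at a.e. v is `symmPowerParams (n-1) a b` where {a, b} is read off σ₀(Frob_v) through the
L-normalised Satake polynomial (`SymSatakeCompatibleAt`; tree vocabulary `Literature…arithFrobPolyOfSatake`, `…symmPowerParams`).  The Galois
avatar ρ₀ of FC is ELIMINATED.  DICTIONARY (typed and proved here, §4): `arithFrobPoly_pair` ({a,b} ↦ (X − ι⁻¹a⁻¹)(X − ι⁻¹b⁻¹)), `arithFrobPoly_symm`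
(Sym^{n−1}{a,b} ↦ ∏_i (X − x^i y^{n−1−i})), `pair_of_mul_eq` + `shadow_prod_eq` (the shadow relation {a′, a′r} = {x, y} forces the progression
spectrum {a′^{n−1} r^j} = {x^i y^{n−1−i}} — the one non-trivial line: reflect the range when a′ = x), `arithFrobPolyOfSatake_one_injective`
(Satake parameters are determined by the Satake polynomial), `natDegree_charpoly_two`; and two tree THEOREMS that make the converse honest:
`IsDedekindDomain.HeightOneSpectrum.primesAbove_nonempty` and `…exists_isArithFrobAt_of_mem_primesAbove_holds` (a Frobenius EXISTS at every v, so
`HasFrobCharpolyAt` is never vacuous).  AVX («σ₀ has an irreducible pinned-geometric Lie-irreducible Sym^{n−1}-shadow», i.e. Sym^{n−1}σ₀ with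
Zariski closure ⊇ SL₂ and de Rham tensor powers — folklore) is used ONLY in the certificates, never in `closes`; it is not a route item.
WHY THE EQUIV IS NOT COSTUME: (i) it carries the split of §2 (three pieces, two strictly weaker open populations + one print population);
(ii) it retires the host's typing risk flagged in the g14 memo («IsSymShadow vs Satake bookkeeping») for 28219 by PROVING the bookkeeping.

## 2. The SPLIT beneath the EQUIV: the SEED–REACH TRICHOTOMY, certified `spf_iff_pieces` (EXACT: SPF ↔ A ∧ B ∧ C)

Over a CM field Newton–Thorne's architecture («automorphy of Sym^{n−1} is constant along p-adic families; find ONE seed point») survives with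
«irreducible component of the eigencurve» replaced by «ADMISSIBLE Sym^{n−1}-CONGRUENCE CLASS»: the edge `AdmissibleSymCongruence K₀ n hcpt₂ π π′`
between cohomological cuspidal π, π′ on GL₂/K₀ packages EXACTLY hypotheses (1)–(5) of the PRINT non-polarised automorphy lifting theorem over CM
fields, ACC+ Thm 6.1.1 (arXiv:1812.09999 p.64: p > n² unramified in K₀, both forms unramified above p, common regular L-algebraic infinity type with
Fontaine–Laffaille-small Sym^{n−1}-weight, p-adic avatars s, s′ whose Sym^{n−1}-shadows R, R′ share a residual representation τ that is absolutely
irreducible, decomposed generic, absolutely irreducible with ENORMOUS image on Γ_{K₀(ζ_p)}, with a scalar outside — the vocabulary of the tree fact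
`Literature…ACCGHLNSTT2023.automorphyLifting_crystalline_weightZero`), so that Sym^{n−1}-automorphy PROPAGATES along edges by a theorem.  The open
content of FC is therefore «SEED + REACH», and the population of σ₀'s splits by the reach of its partner's congruence class
(`Relation.ReflTransGen` of the edge) into three cells, cut by two excluded middles:

* A `BaseChangeSeededSymPower` — the class reaches a BASE-CHANGE form (`IsBaseChangeForm`: an avatar is χ ⊗ σ_F|Γ_{K₀}, σ_F irreducible
  pinned-geometric over a totally real F ⊂ K₀ of index 2 — the host's planned rung `stub_cmBaseChangeAnchor`, verbatim clause).
  Tags: WEAKER(kernel `a_of_spf`; A is SPF on a sub-population and is PRINT, so A ⇏ SPF unless FC is print) · PRINT(NewtonThorne2022 Thm 1 for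
  π_F [regular algebraic and non-CM are forced: BC_{K₀/F}(π_F) ≃ β ⊗ χ′ is cohomological and σ₀ is Lie-irreducible] + ArthurClozel quadratic base
  change GL_n + cuspidality of Sym^{n−1} from Lie-irreducibility + ACC+ 6.1.1 along each edge, with crystallinity/HT weights at p from
  A'Campo–Hevesi–Thorne–Whitmore 2026 and the identifications by Chebotarev/Brauer–Nesbitt/JS) · ATTACKABLE-NOW (typer chain T-A, est. L/XL;
  first rung = chain length 0 = the host's `stub_cmBaseChangeAnchor`).
* B `ThetaSeededSymPower` — the class does not reach base change but reaches an EISENSTEIN/THETA form (`IsThetaForm`: at a prime p > n² the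
  residual representation is NOT absolutely irreducible on Γ_M for a CM field M ⊇ K₀ with [M:K₀] ≤ 2; M = K₀: Eisenstein congruence
  r̄ ~ χ̄₁ ⊕ χ̄₂ (Skinner–Wiles' seed); [M:K₀] = 2: theta congruence r̄ ~ Ind_M ψ̄ (Newton–Thorne's seed, NT21a Thm 5: «choose f congruent
  modulo p to a theta series … Sym^{n−1} r̄|G_K is a sum of characters, so its residual automorphy can be verified»)).
  Tags: WEAKER(kernel `b_of_spf`; misses population C) · OPEN · IDEA-NEEDED with a NAMED missing theorem RedALT = «automorphy lifting for
  NON-POLARISED n-dimensional crystalline FL representations of Γ_M, M CM, p > n², whose residual representation is a SUM OF CHARACTERS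
  (residually Eisenstein)» — the GL_n cousin of live route SkinnerWilesDefectOne (GL₂, ordinary, defect one) and the non-polarised cousin of
  Allen–Newton–Thorne 2020 (polarised, doi:10.1112/s0010437x20007484); given RedALT, B is print (Sym^{n−1} r_β|Γ_M residually automorphic for
  free ⇒ automorphic over M ⇒ cyclic descent M/K₀ (ArthurClozel; Π_M cuspidal since β is Lie-irreducible, the right descent picked on Γ_M) ⇒
  ACC+ along the chain as in A).  Population non-empty: UNDECIDED with stated test I-B (instrument: a genuine = non-base-change cohomological
  Bianchi newform with an Eisenstein or CM congruence at a prime p ≥ 37 unramified in K₀; existence of Eisenstein congruences over imaginary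
  quadratic fields is Berger 2009 Compositio 145 doi:10.1112/S0010437X09003984, genuineness of some of them is the census question).
* C `SeedIsolatedSymPower` — the class reaches neither seed type.  DECLARED RESIDUAL.  Tags: WEAKER(kernel `c_of_spf`; C ∧ A ⇒ SPF needs B,
  which is open — strictly weaker as long as population B is non-empty, test I-B) · OPEN · INSTRUMENTABLE (test I-C: the admissible
  Sym^{n−1}-congruence graph of genuine weight-2 Bianchi newforms over ℚ(i), ℚ(√−2), ℚ(√−3), ℚ(√−7), ℚ(√−11) from LMFDB Hecke data: which genuine
  forms are congruent at some p ≥ 37 to a base-change / CM / Eisenstein form; heuristically C is SPARSE — level raising makes congruence classes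
  large — but no theorem says it is empty: that emptiness, «every genuine cohomological π₀ over a CM field is admissibly congruence-connected to
  a seed», is the honest open residue REACH, smaller than FC by the two named populations) · IDEA-NEEDED (a CM-field substitute for the
  eigenvariety ping-pong of NT21a §3–4: positive-dimensional propagation is unavailable since classical points are not Zariski dense at l₀ ≥ 1).
* support FRAME″ `SeedReachFrame := SPF → Langlands`, certified `frame_of_host` from the host's RES, LS, FT, CSD, T′, FRAME′ through
  `SymmetricPowerAnchorSplit.closes` fed with `fc_of_spf`; `frame_of_langlands` trivial.

`closes (hA) (hB) (hC) (hF) : _root_.Langlands := hF (spf_of_pieces hA hB hC)` — axioms propext · Classical.choice · Quot.sound.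
NECESSITY: `spf_of_langlands`, `a_of_langlands`, `b_of_langlands`, `c_of_langlands` (all via `cm_of_langlands` of the twin, modulo AVX),
`frame_of_langlands`; `langlands_iff_items (hAV) : Langlands ↔ A ∧ B ∧ C ∧ FRAME″`.

WHY THIS IS NOVEL. No route of the summit and no node of the cell types the ACC+ hypotheses as a CONGRUENCE GRAPH on cohomological forms and
splits a functoriality statement by REACHABILITY OF SEEDS in it; the own-lineage root route CongruenceGraphSplit (g3) has vertices = Satake
families, anchors = residual automorphy and an OPEN lifting engine, whereas here the engine on edges is PRINT (ACC+ 6.1.1) and the open content is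
isolated in two named seed problems (B: a reducible non-polarised ALT = a named theorem-to-be; C: reach).  Newton–Thorne's theta seed has never been
posed over a CM field in print (searches: corpus fts+vec «symmetric power functoriality CM field», «residually reducible automorphy lifting»;
galaxy «residually reducible», «Skinner-Wiles|Skinner and Wiles» (0 pdf hits), «symmetric power» — nearest [corpus:paper:arxiv-1912.11261 p4–5],
[corpus:paper:arxiv-1812.09999 p64], [corpus:doi:10.1112/s0010437x20007484], [galaxy:pdf:3692044544767420] ANT 13(5)).
WHY EACH PIECE IS STRICTLY WEAKER: A, B, C are SPF restricted to three disjoint populations (kernels `a_of_spf`, `b_of_spf`, `c_of_spf`); A is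
print and B, C are open and non-empty-or-tested (I-B, I-C), so no single piece gives SPF (hence FC, hence S) back: A ∧ C ⇒ SPF needs B (open),
A ∧ B ⇒ SPF needs C (open), B ∧ C ⇒ SPF needs A (print but not in the tree: a typer target, not a hypothesis of `closes`).
-/


set_option linter.unusedVariables false
set_option linter.unusedSectionVars false
set_option linter.dupNamespace false

namespace Summit.Langlands.Langlands.Theorems.SeedReach

open Polynomial
open Summit.Langlands.Langlands.Theses.SymmetricPowerAnchorSplit (AnchorlessSymTypeAutomorphy CMSymmetricPowerAutomorphy
  LowSymmetricPowerAutomorphy HilbertSymmetricPowerAutomorphy CliffordSolvableDescent SolvableAnchorTransport AvatarSymmetricPowerFrame)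
open Summit.Langlands.Langlands.Theorems.MonodromyDichotomySymmetricPowerAnchor (IsPinnedGeometric IsLieIrreducible RankIH IsSymShadow
  HasCohomologicalPartner IsWeaklyAutomorphic cm_of_langlands)

/-! ## §1 Vocabulary of the second language (automorphic Sym-clothing) and of the seed graph -/

/-- `Sym^(n-1)`-SATAKE COMPATIBILITY at `v` (L-normalised, `m = 1`) of a form `P` on `GL_n/K₀` with the 2-dimensional `σ₀`:
`σ₀` is unramified at `v` with Frobenius characteristic polynomial the Satake polynomial of a pair `{a, b}`, and `P_v` has
Satake parameter `Sym^(n-1){a,b} = {a^i b^(n-1-i)}` (`Literature…symmPowerParams`). -/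
def SymSatakeCompatibleAt {K₀ : Type} [Field K₀] [NumberField K₀] {n : ℕ} {hcpt : Literature.NumberTheory.Automorphic.isCompact_glFiniteIntegralLevel n K₀}
    {ℓ : ℕ} [Fact ℓ.Prime] (ι : PadicAlgCl ℓ ≃+* ℂ) (P : Literature.NumberTheory.Automorphic.CuspidalAutomorphicRepData n K₀ hcpt)
    (σ₀ : Literature.NumberTheory.GaloisRepresentations.FramedGaloisRep K₀ (PadicAlgCl ℓ) 2) (v : IsDedekindDomain.HeightOneSpectrum (NumberField.RingOfIntegers K₀)) : Prop :=
  ∃ a b : ℂ, σ₀.IsUnramifiedAt v ∧ σ₀.HasFrobCharpolyAt v (Literature.NumberTheory.Automorphic.arithFrobPolyOfSatake ι v.residueCard 1 ({a, b} : Multiset ℂ)) ∧ P.1.HasSatakeParamAt v (Literature.NumberTheory.Automorphic.symmPowerParams (n - 1) a b)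

/-- `σ₀` is `Sym^(n-1)`-WEAKLY AUTOMORPHIC at level datum `hcpt`: an L-algebraic cuspidal `P` on `GL_n/K₀`, a.e. `Sym^(n-1)`-Satake
compatible with `σ₀`. -/
def IsSymWeaklyAutomorphic (K₀ : Type) [Field K₀] [NumberField K₀] (n : ℕ) (hcpt : Literature.NumberTheory.Automorphic.isCompact_glFiniteIntegralLevel n K₀)
    (ℓ : ℕ) [Fact ℓ.Prime] (ι : PadicAlgCl ℓ ≃+* ℂ) (σ₀ : Literature.NumberTheory.GaloisRepresentations.FramedGaloisRep K₀ (PadicAlgCl ℓ) 2) : Prop :=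
  ∃ P : Literature.NumberTheory.Automorphic.CuspidalAutomorphicRepData n K₀ hcpt, P.1.IsLAlgebraic ∧ ∀ᶠ v : IsDedekindDomain.HeightOneSpectrum (NumberField.RingOfIntegers K₀) in Filter.cofinite, ∃ a b : ℂ, σ₀.IsUnramifiedAt v ∧ σ₀.HasFrobCharpolyAt v (Literature.NumberTheory.Automorphic.arithFrobPolyOfSatake ι v.residueCard 1 ({a, b} : Multiset ℂ)) ∧ P.1.HasSatakeParamAt v (Literature.NumberTheory.Automorphic.symmPowerParams (n - 1) a b)

/-- EDGE of the seed graph: an ADMISSIBLE `Sym^(n-1)`-CONGRUENCE between cuspidal `π, π'` on `GL₂/K₀` — at a prime `p > n²`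
unramified in `K₀`, above which both forms are unramified, both of the same regular L-algebraic infinity type `T` with
Fontaine–Laffaille-small `Sym^(n-1)`-weight (`(n-1)(d_e + d_ē) + 2 < p`), with `p`-adic avatars `s, s'` whose `Sym^(n-1)`-shadows
`R, R'` have a COMMON residual representation `τ` carrying the ACC+ package (abs. irreducible, decomposed generic, abs. irreducible
and enormous on `Γ_(K₀(ζ_p))`, a scalar outside it) — exactly hypotheses (2)–(5) of ACC+ Thm 6.1.1 for `ρ = Sym^(n-1) r_(π,p)`
seeded by `Sym^(n-1) π'` (vocabulary of the tree fact `…ACCGHLNSTT2023.automorphyLifting_crystalline_weightZero`). -/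
def AdmissibleSymCongruence (K₀ : Type) [Field K₀] [NumberField K₀] (n : ℕ) (hcpt₂ : Literature.NumberTheory.Automorphic.isCompact_glFiniteIntegralLevel 2 K₀)
    (π π' : Literature.NumberTheory.Automorphic.CuspidalAutomorphicRepData 2 K₀ hcpt₂) : Prop :=
  ∃ (p : ℕ) (_ : Fact p.Prime) (ι' : PadicAlgCl p ≃+* ℂ) (T : Literature.NumberTheory.Automorphic.InfinityType K₀ 2) (s s' : Literature.NumberTheory.GaloisRepresentations.FramedGaloisRep K₀ (PadicAlgCl p) 2) (R R' : Literature.NumberTheory.GaloisRepresentations.FramedGaloisRep K₀ (PadicAlgCl p) n) (τ : Field.absoluteGaloisGroup K₀ →* Matrix.GeneralLinearGroup (Fin n) (Literature.NumberTheory.GaloisRepresentations.padicAlgClResidueField p)), n ^ 2 < p ∧ Algebra.IsUnramifiedIn (NumberField.RingOfIntegers K₀) (Ideal.span {(p : ℤ)}) ∧ (∀ v : IsDedekindDomain.HeightOneSpectrum (NumberField.RingOfIntegers K₀), ((p : ℕ) : NumberField.RingOfIntegers K₀) ∈ v.asIdeal → π.1.IsUnramifiedAt v ∧ π'.1.IsUnramifiedAt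 v) ∧ π.1.HasInfinityType T ∧ π'.1.HasInfinityType T ∧ T.IsLAlgebraic ∧ T.IsRegular ∧ (∀ e : K₀ →+* ℂ, ∀ w₁ ∈ T e, ∀ w₂ ∈ T e, ((n : ℝ) - 1) * (‖w₁.a - w₂.a‖ + ‖w₁.b - w₂.b‖ + 2) + 2 * n < (p : ℝ)) ∧ (∀ᶠ v : IsDedekindDomain.HeightOneSpectrum (NumberField.RingOfIntegers K₀) in Filter.cofinite, SatakeFrobCompatibleAt ι' π.1 s v) ∧ (∀ᶠ v : IsDedekindDomain.HeightOneSpectrum (NumberField.RingOfIntegers K₀) in Filter.cofinite, SatakeFrobCompatibleAt ι' π'.1 s' v) ∧ Summit.Langlands.Langlands.Theorems.MonodromyDichotomySymmetricPowerAnchor.IsSymShadow K₀ p n R s ∧ Summit.Langlands.Langlands.Theorems.MonodromyDichotomySymmetricPowerAnchor.IsSymShadow K₀ p n R' s' ∧ R.IsResidualRepOf (RingHom.id _) τ ∧ R'.IsResidualRepOf (RingHom.id _) τ ∧ Literature.NumberTheory.GaloisRepresentations.IsAbsIrreducible τ ∧ Literature.NumberTheory.GaloisRepresentations.IsDecomposedGeneric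 τ ∧ Literature.NumberTheory.GaloisRepresentations.IsAbsIrreducible (τ.comp (Literature.NumberTheory.GaloisRepresentations.absGaloisGroupAdjoinRootsOfUnity K₀ p).subtype) ∧ Literature.NumberTheory.GaloisRepresentations.Subgroup.IsEnormous ((Literature.NumberTheory.GaloisRepresentations.absGaloisGroupAdjoinRootsOfUnity K₀ p).map τ) ∧ ∃ g₀ : Field.absoluteGaloisGroup K₀, g₀ ∉ Literature.NumberTheory.GaloisRepresentations.absGaloisGroupAdjoinRootsOfUnity K₀ p ∧ ∃ c : Literature.NumberTheory.GaloisRepresentations.padicAlgClResidueField p, ((τ g₀ : Matrix.GeneralLinearGroup (Fin n) (Literature.NumberTheory.GaloisRepresentations.padicAlgClResidueField p)) : Matrix (Fin n) (Fin n) (Literature.NumberTheory.GaloisRepresentations.padicAlgClResidueField p)) = c • (1 : Matrix (Fin n) (Fin n) (Literature.NumberTheory.GaloisRepresentations.padicAlgClResidueField p))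

/-- SEED TYPE I — BASE-CHANGE FORM: some avatar of `π` is a character twist of `σ_F|Γ_(K₀)` for an irreducible pinned-geometric
`σ_F` over a totally real `F ⊂ K₀` of index 2 (the host's planned first rung `stub_cmBaseChangeAnchor`, verbatim clause). -/
def IsBaseChangeForm (K₀ : Type) [Field K₀] [NumberField K₀] (hcpt₂ : Literature.NumberTheory.Automorphic.isCompact_glFiniteIntegralLevel 2 K₀)
    (π : Literature.NumberTheory.Automorphic.CuspidalAutomorphicRepData 2 K₀ hcpt₂) : Prop :=
  ∃ (p : ℕ) (_ : Fact p.Prime) (ι' : PadicAlgCl p ≃+* ℂ) (s : Literature.NumberTheory.GaloisRepresentations.FramedGaloisRep K₀ (PadicAlgCl p) 2), (∀ᶠ v : IsDedekindDomain.HeightOneSpectrum (NumberField.RingOfIntegers K₀) in Filter.cofinite, SatakeFrobCompatibleAt ι' π.1 s v) ∧ ∃ (F : Type) (_ : Field F) (_ : NumberField F) (_ : Algebra F K₀), NumberField.IsTotallyReal F ∧ Module.finrank F K₀ = 2 ∧ ∃ (sF : Literature.NumberTheory.GaloisRepresentations.FramedGaloisRep F (PadicAlgCl p) 2) (χ : Field.absoluteGaloisGroup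 K₀ →* PadicAlgCl p), sF.toGaloisRep.IsIrreducible ∧ Summit.Langlands.Langlands.Theorems.MonodromyDichotomySymmetricPowerAnchor.IsPinnedGeometric F p sF ∧ ∀ g : Field.absoluteGaloisGroup K₀, Literature.NumberTheory.GaloisRepresentations.FramedRep.charpoly s g = (Literature.NumberTheory.GaloisRepresentations.FramedRep.charpoly (sF.restrictField K₀) g).scaleRoots (χ g)

/-- SEED TYPE II — EISENSTEIN/THETA FORM (Newton–Thorne's theta seed and Skinner–Wiles' Eisenstein seed, transplanted): at some
prime `p > n²` an avatar of `π` is residually NOT absolutely irreducible after restriction to a CM field `M ⊇ K₀` with `[M:K₀] ≤ 2`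
(`M = K₀`: an EISENSTEIN congruence, `r̄ ~ χ̄₁ ⊕ χ̄₂`; `[M:K₀] = 2`: a THETA congruence, `r̄ ~ Ind_M ψ̄`) — so that `Sym^(n-1) r̄|Γ_M` is a
sum of characters, i.e. residually automorphic over `M` for free. -/
def IsThetaForm (K₀ : Type) [Field K₀] [NumberField K₀] (n : ℕ) (hcpt₂ : Literature.NumberTheory.Automorphic.isCompact_glFiniteIntegralLevel 2 K₀)
    (π : Literature.NumberTheory.Automorphic.CuspidalAutomorphicRepData 2 K₀ hcpt₂) : Prop :=
  ∃ (p : ℕ) (_ : Fact p.Prime) (ι' : PadicAlgCl p ≃+* ℂ) (s : Literature.NumberTheory.GaloisRepresentations.FramedGaloisRep K₀ (PadicAlgCl p) 2) (τ₂ : Field.absoluteGaloisGroup K₀ →* Matrix.GeneralLinearGroup (Fin 2) (Literature.NumberTheory.GaloisRepresentations.padicAlgClResidueField p)) (M : Type) (_ : Field M) (_ : NumberField M) (_ : Algebra K₀ M), n ^ 2 < p ∧ (∀ᶠ v : IsDedekindDomain.HeightOneSpectrum (NumberField.RingOfIntegers K₀) in Filter.cofinite, SatakeFrobCompatibleAt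 ι' π.1 s v) ∧ s.IsResidualRepOf (RingHom.id _) τ₂ ∧ 0 < Module.finrank K₀ M ∧ Module.finrank K₀ M ≤ 2 ∧ NumberField.IsCMField M ∧ ¬ Literature.NumberTheory.GaloisRepresentations.IsAbsIrreducible (τ₂.comp (Literature.NumberTheory.GaloisRepresentations.absGaloisRestrictMonoidHom K₀ M))

/-- DIAL A — `σ₀` is BASE-CHANGE-REACHABLE: its cohomological partner `π₀` is joined to a base-change form by a finite chain of
admissible `Sym^(n-1)`-congruences (`Relation.ReflTransGen`). -/
def BCReachable (K₀ : Type) [Field K₀] [NumberField K₀] (n : ℕ) (ℓ : ℕ) [Fact ℓ.Prime] (ι : PadicAlgCl ℓ ≃+* ℂ)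
    (σ₀ : Literature.NumberTheory.GaloisRepresentations.FramedGaloisRep K₀ (PadicAlgCl ℓ) 2) : Prop :=
  ∃ (hcpt₂ : Literature.NumberTheory.Automorphic.isCompact_glFiniteIntegralLevel 2 K₀) (π₀ β : Literature.NumberTheory.Automorphic.CuspidalAutomorphicRepData 2 K₀ hcpt₂), (∀ᶠ v : IsDedekindDomain.HeightOneSpectrum (NumberField.RingOfIntegers K₀) in Filter.cofinite, SatakeFrobCompatibleAt ι π₀.1 σ₀ v) ∧ Relation.ReflTransGen (fun π π' : Literature.NumberTheory.Automorphic.CuspidalAutomorphicRepData 2 K₀ hcpt₂ => ∃ (p : ℕ) (_ : Fact p.Prime) (ι' : PadicAlgCl p ≃+* ℂ) (T : Literature.NumberTheory.Automorphic.InfinityType K₀ 2) (s s' : Literature.NumberTheory.GaloisRepresentations.FramedGaloisRep K₀ (PadicAlgCl p) 2) (R R' : Literature.NumberTheory.GaloisRepresentations.FramedGaloisRep K₀ (PadicAlgCl p) n) (τ : Field.absoluteGaloisGroup K₀ →* Matrix.GeneralLinearGroup (Fin n) (Literature.NumberTheory.GaloisRepresentations.padicAlgClResidueField p)), n ^ 2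 < p ∧ Algebra.IsUnramifiedIn (NumberField.RingOfIntegers K₀) (Ideal.span {(p : ℤ)}) ∧ (∀ v : IsDedekindDomain.HeightOneSpectrum (NumberField.RingOfIntegers K₀), ((p : ℕ) : NumberField.RingOfIntegers K₀) ∈ v.asIdeal → π.1.IsUnramifiedAt v ∧ π'.1.IsUnramifiedAt v) ∧ π.1.HasInfinityType T ∧ π'.1.HasInfinityType T ∧ T.IsLAlgebraic ∧ T.IsRegular ∧ (∀ e : K₀ →+* ℂ, ∀ w₁ ∈ T e, ∀ w₂ ∈ T e, ((n : ℝ) - 1) * (‖w₁.a - w₂.a‖ + ‖w₁.b - w₂.b‖ + 2) + 2 * n < (p : ℝ)) ∧ (∀ᶠ v : IsDedekindDomain.HeightOneSpectrum (NumberField.RingOfIntegers K₀) in Filter.cofinite, SatakeFrobCompatibleAt ι' π.1 s v) ∧ (∀ᶠ v : IsDedekindDomain.HeightOneSpectrum (NumberField.RingOfIntegers K₀) in Filter.cofinite, SatakeFrobCompatibleAt ι' π'.1 s' v) ∧ Summit.Langlands.Langlands.Theorems.MonodromyDichotomySymmetricPowerAnchor.IsSymShadow K₀ p n R s ∧ Summit.Langlands.Langlands.Theorems.MonodromyDichotomySymmetricPowerAnchor.IsSymShadow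 K₀ p n R' s' ∧ R.IsResidualRepOf (RingHom.id _) τ ∧ R'.IsResidualRepOf (RingHom.id _) τ ∧ Literature.NumberTheory.GaloisRepresentations.IsAbsIrreducible τ ∧ Literature.NumberTheory.GaloisRepresentations.IsDecomposedGeneric τ ∧ Literature.NumberTheory.GaloisRepresentations.IsAbsIrreducible (τ.comp (Literature.NumberTheory.GaloisRepresentations.absGaloisGroupAdjoinRootsOfUnity K₀ p).subtype) ∧ Literature.NumberTheory.GaloisRepresentations.Subgroup.IsEnormous ((Literature.NumberTheory.GaloisRepresentations.absGaloisGroupAdjoinRootsOfUnity K₀ p).map τ) ∧ ∃ g₀ : Field.absoluteGaloisGroup K₀, g₀ ∉ Literature.NumberTheory.GaloisRepresentations.absGaloisGroupAdjoinRootsOfUnity K₀ p ∧ ∃ c : Literature.NumberTheory.GaloisRepresentations.padicAlgClResidueField p, ((τ g₀ : Matrix.GeneralLinearGroup (Fin n) (Literature.NumberTheory.GaloisRepresentations.padicAlgClResidueField p)) : Matrix (Fin n) (Fin n) (Literature.NumberTheory.GaloisRepresentations.padicAlgClResidueField p)) = c • (1 : Matrix (Fin n) (Fin n) (Literature.NumberTheory.GaloisRepresentations.padicAlgClResidueField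 p))) π₀ β ∧ ∃ (p : ℕ) (_ : Fact p.Prime) (ι' : PadicAlgCl p ≃+* ℂ) (s : Literature.NumberTheory.GaloisRepresentations.FramedGaloisRep K₀ (PadicAlgCl p) 2), (∀ᶠ v : IsDedekindDomain.HeightOneSpectrum (NumberField.RingOfIntegers K₀) in Filter.cofinite, SatakeFrobCompatibleAt ι' β.1 s v) ∧ ∃ (F : Type) (_ : Field F) (_ : NumberField F) (_ : Algebra F K₀), NumberField.IsTotallyReal F ∧ Module.finrank F K₀ = 2 ∧ ∃ (sF : Literature.NumberTheory.GaloisRepresentations.FramedGaloisRep F (PadicAlgCl p) 2) (χ : Field.absoluteGaloisGroup K₀ →* PadicAlgCl p), sF.toGaloisRep.IsIrreducible ∧ Summit.Langlands.Langlands.Theorems.MonodromyDichotomySymmetricPowerAnchor.IsPinnedGeometric F p sF ∧ ∀ g : Field.absoluteGaloisGroup K₀, Literature.NumberTheory.GaloisRepresentations.FramedRep.charpoly s g = (Literature.NumberTheory.GaloisRepresentations.FramedRep.charpoly (sF.restrictField K₀) g).scaleRoots (χ g)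

/-- DIAL B — `σ₀` is THETA-REACHABLE: its partner is joined to an Eisenstein/theta form by a finite chain of admissible congruences. -/
def ThetaReachable (K₀ : Type) [Field K₀] [NumberField K₀] (n : ℕ) (ℓ : ℕ) [Fact ℓ.Prime] (ι : PadicAlgCl ℓ ≃+* ℂ)
    (σ₀ : Literature.NumberTheory.GaloisRepresentations.FramedGaloisRep K₀ (PadicAlgCl ℓ) 2) : Prop :=
  ∃ (hcpt₂ : Literature.NumberTheory.Automorphic.isCompact_glFiniteIntegralLevel 2 K₀) (π₀ β : Literature.NumberTheory.Automorphic.CuspidalAutomorphicRepData 2 K₀ hcpt₂), (∀ᶠ v : IsDedekindDomain.HeightOneSpectrum (NumberField.RingOfIntegers K₀) in Filter.cofinite, SatakeFrobCompatibleAt ι π₀.1 σ₀ v) ∧ Relation.ReflTransGen (fun π π' : Literature.NumberTheory.Automorphic.CuspidalAutomorphicRepData 2 K₀ hcpt₂ => ∃ (p : ℕ) (_ : Fact p.Prime) (ι' : PadicAlgCl p ≃+* ℂ) (T : Literature.NumberTheory.Automorphic.InfinityType K₀ 2) (s s' : Literature.NumberTheory.GaloisRepresentations.FramedGaloisRep K₀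 (PadicAlgCl p) 2) (R R' : Literature.NumberTheory.GaloisRepresentations.FramedGaloisRep K₀ (PadicAlgCl p) n) (τ : Field.absoluteGaloisGroup K₀ →* Matrix.GeneralLinearGroup (Fin n) (Literature.NumberTheory.GaloisRepresentations.padicAlgClResidueField p)), n ^ 2 < p ∧ Algebra.IsUnramifiedIn (NumberField.RingOfIntegers K₀) (Ideal.span {(p : ℤ)}) ∧ (∀ v : IsDedekindDomain.HeightOneSpectrum (NumberField.RingOfIntegers K₀), ((p : ℕ) : NumberField.RingOfIntegers K₀) ∈ v.asIdeal → π.1.IsUnramifiedAt v ∧ π'.1.IsUnramifiedAt v) ∧ π.1.HasInfinityType T ∧ π'.1.HasInfinityType T ∧ T.IsLAlgebraic ∧ T.IsRegular ∧ (∀ e : K₀ →+* ℂ, ∀ w₁ ∈ T e, ∀ w₂ ∈ T e, ((n : ℝ) - 1) * (‖w₁.a - w₂.a‖ + ‖w₁.b - w₂.b‖ + 2) + 2 * n < (p : ℝ)) ∧ (∀ᶠ v : IsDedekindDomain.HeightOneSpectrum (NumberField.RingOfIntegers K₀) in Filter.cofinite, SatakeFrobCompatibleAt ι' π.1 s v)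 ∧ (∀ᶠ v : IsDedekindDomain.HeightOneSpectrum (NumberField.RingOfIntegers K₀) in Filter.cofinite, SatakeFrobCompatibleAt ι' π'.1 s' v) ∧ Summit.Langlands.Langlands.Theorems.MonodromyDichotomySymmetricPowerAnchor.IsSymShadow K₀ p n R s ∧ Summit.Langlands.Langlands.Theorems.MonodromyDichotomySymmetricPowerAnchor.IsSymShadow K₀ p n R' s' ∧ R.IsResidualRepOf (RingHom.id _) τ ∧ R'.IsResidualRepOf (RingHom.id _) τ ∧ Literature.NumberTheory.GaloisRepresentations.IsAbsIrreducible τ ∧ Literature.NumberTheory.GaloisRepresentations.IsDecomposedGeneric τ ∧ Literature.NumberTheory.GaloisRepresentations.IsAbsIrreducible (τ.comp (Literature.NumberTheory.GaloisRepresentations.absGaloisGroupAdjoinRootsOfUnity K₀ p).subtype) ∧ Literature.NumberTheory.GaloisRepresentations.Subgroup.IsEnormous ((Literature.NumberTheory.GaloisRepresentations.absGaloisGroupAdjoinRootsOfUnity K₀ p).map τ) ∧ ∃ g₀ : Field.absoluteGaloisGroup K₀, g₀ ∉ Literature.NumberTheory.GaloisRepresentations.absGaloisGroupAdjoinRootsOfUnity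 K₀ p ∧ ∃ c : Literature.NumberTheory.GaloisRepresentations.padicAlgClResidueField p, ((τ g₀ : Matrix.GeneralLinearGroup (Fin n) (Literature.NumberTheory.GaloisRepresentations.padicAlgClResidueField p)) : Matrix (Fin n) (Fin n) (Literature.NumberTheory.GaloisRepresentations.padicAlgClResidueField p)) = c • (1 : Matrix (Fin n) (Fin n) (Literature.NumberTheory.GaloisRepresentations.padicAlgClResidueField p))) π₀ β ∧ ∃ (p : ℕ) (_ : Fact p.Prime) (ι' : PadicAlgCl p ≃+* ℂ) (s : Literature.NumberTheory.GaloisRepresentations.FramedGaloisRep K₀ (PadicAlgCl p) 2) (τ₂ : Field.absoluteGaloisGroup K₀ →* Matrix.GeneralLinearGroup (Fin 2) (Literature.NumberTheory.GaloisRepresentations.padicAlgClResidueField p)) (M : Type) (_ : Field M) (_ : NumberField M) (_ : Algebra K₀ M), n ^ 2 < p ∧ (∀ᶠ v : IsDedekindDomain.HeightOneSpectrum (NumberField.RingOfIntegers K₀) in Filter.cofinite, SatakeFrobCompatibleAt ι' β.1 s v) ∧ s.IsResidualRepOf (RingHom.id _) τ₂ ∧ 0 < Module.finrank K₀ M ∧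 Module.finrank K₀ M ≤ 2 ∧ NumberField.IsCMField M ∧ ¬ Literature.NumberTheory.GaloisRepresentations.IsAbsIrreducible (τ₂.comp (Literature.NumberTheory.GaloisRepresentations.absGaloisRestrictMonoidHom K₀ M))

/-! ## §2 The EQUIV node and the pieces (texts = the route items, single source `frag15.py`) -/

/-- X = SPF — `Sym^(n-1)` FUNCTORIALITY AT A CM COHOMOLOGICAL PARTNER, AVATAR-FREE (the certified translation of FC:
`fc_of_spf` outright, `spf_of_fc` modulo the print antecedent `SymPowerAvatarExists`). -/
def SymPowerFunctoriality : Prop :=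
  ∀ (K₀ : Type) [Field K₀] [NumberField K₀] (n : ℕ) (hcpt : Literature.NumberTheory.Automorphic.isCompact_glFiniteIntegralLevel n K₀), 6 ≤ n → Summit.Langlands.Langlands.Theorems.MonodromyDichotomySymmetricPowerAnchor.RankIH n → NumberField.IsCMField K₀ → ∀ (ℓ : ℕ) [Fact ℓ.Prime] (ι : PadicAlgCl ℓ ≃+* ℂ) (σ₀ : Literature.NumberTheory.GaloisRepresentations.FramedGaloisRep K₀ (PadicAlgCl ℓ) 2), σ₀.toGaloisRep.IsIrreducible → Summit.Langlands.Langlands.Theorems.MonodromyDichotomySymmetricPowerAnchor.IsPinnedGeometric K₀ ℓ σ₀ → Summit.Langlands.Langlands.Theorems.MonodromyDichotomySymmetricPowerAnchor.IsLieIrreducible K₀ ℓ σ₀ → Summit.Langlands.Langlands.Theorems.MonodromyDichotomySymmetricPowerAnchor.HasCohomologicalPartner K₀ ℓ ι σ₀ → ∃ P : Literature.NumberTheory.Automorphic.CuspidalAutomorphicRepData n K₀ hcpt, P.1.IsLAlgebraic ∧ ∀ᶠ v : IsDedekindDomain.HeightOneSpectrum (NumberField.RingOfIntegers K₀) in Filter.cofinite,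 ∃ a b : ℂ, σ₀.IsUnramifiedAt v ∧ σ₀.HasFrobCharpolyAt v (Literature.NumberTheory.Automorphic.arithFrobPolyOfSatake ι v.residueCard 1 ({a, b} : Multiset ℂ)) ∧ P.1.HasSatakeParamAt v (Literature.NumberTheory.Automorphic.symmPowerParams (n - 1) a b)

/-- piece A — BASE-CHANGE-SEEDED `Sym^(n-1)` (PRINT: NT22 + AC + ACC+ along the chain; ATTACKABLE-NOW typer chain). -/
def BaseChangeSeededSymPower : Prop :=
  ∀ (K₀ : Type) [Field K₀] [NumberField K₀] (n : ℕ) (hcpt : Literature.NumberTheory.Automorphic.isCompact_glFiniteIntegralLevel n K₀), 6 ≤ n → Summit.Langlands.Langlands.Theorems.MonodromyDichotomySymmetricPowerAnchor.RankIH n → NumberField.IsCMField K₀ → ∀ (ℓ : ℕ) [Fact ℓ.Prime] (ι : PadicAlgCl ℓ ≃+* ℂ) (σ₀ : Literature.NumberTheory.GaloisRepresentations.FramedGaloisRep K₀ (PadicAlgCl ℓ) 2), σ₀.toGaloisRep.IsIrreducible → Summit.Langlands.Langlands.Theorems.MonodromyDichotomySymmetricPowerAnchor.IsPinnedGeometric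 K₀ ℓ σ₀ → Summit.Langlands.Langlands.Theorems.MonodromyDichotomySymmetricPowerAnchor.IsLieIrreducible K₀ ℓ σ₀ → Summit.Langlands.Langlands.Theorems.MonodromyDichotomySymmetricPowerAnchor.HasCohomologicalPartner K₀ ℓ ι σ₀ → (∃ (hcpt₂ : Literature.NumberTheory.Automorphic.isCompact_glFiniteIntegralLevel 2 K₀) (π₀ β : Literature.NumberTheory.Automorphic.CuspidalAutomorphicRepData 2 K₀ hcpt₂), (∀ᶠ v : IsDedekindDomain.HeightOneSpectrum (NumberField.RingOfIntegers K₀) in Filter.cofinite, SatakeFrobCompatibleAt ι π₀.1 σ₀ v) ∧ Relation.ReflTransGen (fun π π' : Literature.NumberTheory.Automorphic.CuspidalAutomorphicRepData 2 K₀ hcpt₂ => ∃ (p : ℕ) (_ : Fact p.Prime) (ι' : PadicAlgCl p ≃+* ℂ) (T : Literature.NumberTheory.Automorphic.InfinityType K₀ 2) (s s' : Literature.NumberTheory.GaloisRepresentations.FramedGaloisRep K₀ (PadicAlgCl p) 2) (R R' : Literature.NumberTheory.GaloisRepresentations.FramedGaloisRep K₀ (PadicAlgCl p) n) (τ : Field.absoluteGaloisGroup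 K₀ →* Matrix.GeneralLinearGroup (Fin n) (Literature.NumberTheory.GaloisRepresentations.padicAlgClResidueField p)), n ^ 2 < p ∧ Algebra.IsUnramifiedIn (NumberField.RingOfIntegers K₀) (Ideal.span {(p : ℤ)}) ∧ (∀ v : IsDedekindDomain.HeightOneSpectrum (NumberField.RingOfIntegers K₀), ((p : ℕ) : NumberField.RingOfIntegers K₀) ∈ v.asIdeal → π.1.IsUnramifiedAt v ∧ π'.1.IsUnramifiedAt v) ∧ π.1.HasInfinityType T ∧ π'.1.HasInfinityType T ∧ T.IsLAlgebraic ∧ T.IsRegular ∧ (∀ e : K₀ →+* ℂ, ∀ w₁ ∈ T e, ∀ w₂ ∈ T e, ((n : ℝ) - 1) * (‖w₁.a - w₂.a‖ + ‖w₁.b - w₂.b‖ + 2) + 2 * n < (p : ℝ)) ∧ (∀ᶠ v : IsDedekindDomain.HeightOneSpectrum (NumberField.RingOfIntegers K₀) in Filter.cofinite, SatakeFrobCompatibleAt ι' π.1 s v) ∧ (∀ᶠ v : IsDedekindDomain.HeightOneSpectrum (NumberField.RingOfIntegers K₀) in Filter.cofinite, SatakeFrobCompatibleAt ι' π'.1 s'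 v) ∧ Summit.Langlands.Langlands.Theorems.MonodromyDichotomySymmetricPowerAnchor.IsSymShadow K₀ p n R s ∧ Summit.Langlands.Langlands.Theorems.MonodromyDichotomySymmetricPowerAnchor.IsSymShadow K₀ p n R' s' ∧ R.IsResidualRepOf (RingHom.id _) τ ∧ R'.IsResidualRepOf (RingHom.id _) τ ∧ Literature.NumberTheory.GaloisRepresentations.IsAbsIrreducible τ ∧ Literature.NumberTheory.GaloisRepresentations.IsDecomposedGeneric τ ∧ Literature.NumberTheory.GaloisRepresentations.IsAbsIrreducible (τ.comp (Literature.NumberTheory.GaloisRepresentations.absGaloisGroupAdjoinRootsOfUnity K₀ p).subtype) ∧ Literature.NumberTheory.GaloisRepresentations.Subgroup.IsEnormous ((Literature.NumberTheory.GaloisRepresentations.absGaloisGroupAdjoinRootsOfUnity K₀ p).map τ) ∧ ∃ g₀ : Field.absoluteGaloisGroup K₀, g₀ ∉ Literature.NumberTheory.GaloisRepresentations.absGaloisGroupAdjoinRootsOfUnity K₀ p ∧ ∃ c : Literature.NumberTheory.GaloisRepresentations.padicAlgClResidueField p, ((τ g₀ : Matrix.GeneralLinearGroup (Fin n) (Literature.NumberTheory.GaloisRepresentations.padicAlgClResidueField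 p)) : Matrix (Fin n) (Fin n) (Literature.NumberTheory.GaloisRepresentations.padicAlgClResidueField p)) = c • (1 : Matrix (Fin n) (Fin n) (Literature.NumberTheory.GaloisRepresentations.padicAlgClResidueField p))) π₀ β ∧ ∃ (p : ℕ) (_ : Fact p.Prime) (ι' : PadicAlgCl p ≃+* ℂ) (s : Literature.NumberTheory.GaloisRepresentations.FramedGaloisRep K₀ (PadicAlgCl p) 2), (∀ᶠ v : IsDedekindDomain.HeightOneSpectrum (NumberField.RingOfIntegers K₀) in Filter.cofinite, SatakeFrobCompatibleAt ι' β.1 s v) ∧ ∃ (F : Type) (_ : Field F) (_ : NumberField F) (_ : Algebra F K₀), NumberField.IsTotallyReal F ∧ Module.finrank F K₀ = 2 ∧ ∃ (sF : Literature.NumberTheory.GaloisRepresentations.FramedGaloisRep F (PadicAlgCl p) 2) (χ : Field.absoluteGaloisGroup K₀ →* PadicAlgCl p), sF.toGaloisRep.IsIrreducible ∧ Summit.Langlands.Langlands.Theorems.MonodromyDichotomySymmetricPowerAnchor.IsPinnedGeometric F p sF ∧ ∀ g : Field.absoluteGaloisGroup K₀, Literature.NumberTheory.GaloisRepresentations.FramedRep.charpoly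 s g = (Literature.NumberTheory.GaloisRepresentations.FramedRep.charpoly (sF.restrictField K₀) g).scaleRoots (χ g)) → ∃ P : Literature.NumberTheory.Automorphic.CuspidalAutomorphicRepData n K₀ hcpt, P.1.IsLAlgebraic ∧ ∀ᶠ v : IsDedekindDomain.HeightOneSpectrum (NumberField.RingOfIntegers K₀) in Filter.cofinite, ∃ a b : ℂ, σ₀.IsUnramifiedAt v ∧ σ₀.HasFrobCharpolyAt v (Literature.NumberTheory.Automorphic.arithFrobPolyOfSatake ι v.residueCard 1 ({a, b} : Multiset ℂ)) ∧ P.1.HasSatakeParamAt v (Literature.NumberTheory.Automorphic.symmPowerParams (n - 1) a b)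

/-- piece B — EISENSTEIN/THETA-SEEDED `Sym^(n-1)` (OPEN: Newton–Thorne's seed theorem over a CM field = residually REDUCIBLE,
NON-POLARISED automorphy lifting for `Sym^(n-1) r|Γ_M` over the CM field `M` (the `GL_n` cousin of live route SkinnerWilesDefectOne), cyclic
descent `M/K₀`, then ACC+ along the chain). -/
def ThetaSeededSymPower : Prop :=
  ∀ (K₀ : Type) [Field K₀] [NumberField K₀] (n : ℕ) (hcpt : Literature.NumberTheory.Automorphic.isCompact_glFiniteIntegralLevel n K₀), 6 ≤ n → Summit.Langlands.Langlands.Theorems.MonodromyDichotomySymmetricPowerAnchor.RankIH n → NumberField.IsCMField K₀ → ∀ (ℓ : ℕ) [Fact ℓ.Prime] (ι : PadicAlgCl ℓ ≃+* ℂ) (σ₀ : Literature.NumberTheory.GaloisRepresentations.FramedGaloisRep K₀ (PadicAlgCl ℓ) 2), σ₀.toGaloisRep.IsIrreducible → Summit.Langlands.Langlands.Theorems.MonodromyDichotomySymmetricPowerAnchor.IsPinnedGeometric K₀ ℓ σ₀ → Summit.Langlands.Langlands.Theorems.MonodromyDichotomySymmetricPowerAnchor.IsLieIrreducible K₀ ℓ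 σ₀ → Summit.Langlands.Langlands.Theorems.MonodromyDichotomySymmetricPowerAnchor.HasCohomologicalPartner K₀ ℓ ι σ₀ → ¬ (∃ (hcpt₂ : Literature.NumberTheory.Automorphic.isCompact_glFiniteIntegralLevel 2 K₀) (π₀ β : Literature.NumberTheory.Automorphic.CuspidalAutomorphicRepData 2 K₀ hcpt₂), (∀ᶠ v : IsDedekindDomain.HeightOneSpectrum (NumberField.RingOfIntegers K₀) in Filter.cofinite, SatakeFrobCompatibleAt ι π₀.1 σ₀ v) ∧ Relation.ReflTransGen (fun π π' : Literature.NumberTheory.Automorphic.CuspidalAutomorphicRepData 2 K₀ hcpt₂ => ∃ (p : ℕ) (_ : Fact p.Prime) (ι' : PadicAlgCl p ≃+* ℂ) (T : Literature.NumberTheory.Automorphic.InfinityType K₀ 2) (s s' : Literature.NumberTheory.GaloisRepresentations.FramedGaloisRep K₀ (PadicAlgCl p) 2) (R R' : Literature.NumberTheory.GaloisRepresentations.FramedGaloisRep K₀ (PadicAlgCl p) n) (τ : Field.absoluteGaloisGroup K₀ →* Matrix.GeneralLinearGroup (Fin n) (Literature.NumberTheory.GaloisRepresentations.padicAlgClResidueField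 p)), n ^ 2 < p ∧ Algebra.IsUnramifiedIn (NumberField.RingOfIntegers K₀) (Ideal.span {(p : ℤ)}) ∧ (∀ v : IsDedekindDomain.HeightOneSpectrum (NumberField.RingOfIntegers K₀), ((p : ℕ) : NumberField.RingOfIntegers K₀) ∈ v.asIdeal → π.1.IsUnramifiedAt v ∧ π'.1.IsUnramifiedAt v) ∧ π.1.HasInfinityType T ∧ π'.1.HasInfinityType T ∧ T.IsLAlgebraic ∧ T.IsRegular ∧ (∀ e : K₀ →+* ℂ, ∀ w₁ ∈ T e, ∀ w₂ ∈ T e, ((n : ℝ) - 1) * (‖w₁.a - w₂.a‖ + ‖w₁.b - w₂.b‖ + 2) + 2 * n < (p : ℝ)) ∧ (∀ᶠ v : IsDedekindDomain.HeightOneSpectrum (NumberField.RingOfIntegers K₀) in Filter.cofinite, SatakeFrobCompatibleAt ι' π.1 s v) ∧ (∀ᶠ v : IsDedekindDomain.HeightOneSpectrum (NumberField.RingOfIntegers K₀) in Filter.cofinite, SatakeFrobCompatibleAt ι' π'.1 s' v) ∧ Summit.Langlands.Langlands.Theorems.MonodromyDichotomySymmetricPowerAnchor.IsSymShadow K₀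 p n R s ∧ Summit.Langlands.Langlands.Theorems.MonodromyDichotomySymmetricPowerAnchor.IsSymShadow K₀ p n R' s' ∧ R.IsResidualRepOf (RingHom.id _) τ ∧ R'.IsResidualRepOf (RingHom.id _) τ ∧ Literature.NumberTheory.GaloisRepresentations.IsAbsIrreducible τ ∧ Literature.NumberTheory.GaloisRepresentations.IsDecomposedGeneric τ ∧ Literature.NumberTheory.GaloisRepresentations.IsAbsIrreducible (τ.comp (Literature.NumberTheory.GaloisRepresentations.absGaloisGroupAdjoinRootsOfUnity K₀ p).subtype) ∧ Literature.NumberTheory.GaloisRepresentations.Subgroup.IsEnormous ((Literature.NumberTheory.GaloisRepresentations.absGaloisGroupAdjoinRootsOfUnity K₀ p).map τ) ∧ ∃ g₀ : Field.absoluteGaloisGroup K₀, g₀ ∉ Literature.NumberTheory.GaloisRepresentations.absGaloisGroupAdjoinRootsOfUnity K₀ p ∧ ∃ c : Literature.NumberTheory.GaloisRepresentations.padicAlgClResidueField p, ((τ g₀ : Matrix.GeneralLinearGroup (Fin n) (Literature.NumberTheory.GaloisRepresentations.padicAlgClResidueField p)) : Matrix (Fin n) (Fin n) (Literature.NumberTheory.GaloisRepresentations.padicAlgClResidueField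 p)) = c • (1 : Matrix (Fin n) (Fin n) (Literature.NumberTheory.GaloisRepresentations.padicAlgClResidueField p))) π₀ β ∧ ∃ (p : ℕ) (_ : Fact p.Prime) (ι' : PadicAlgCl p ≃+* ℂ) (s : Literature.NumberTheory.GaloisRepresentations.FramedGaloisRep K₀ (PadicAlgCl p) 2), (∀ᶠ v : IsDedekindDomain.HeightOneSpectrum (NumberField.RingOfIntegers K₀) in Filter.cofinite, SatakeFrobCompatibleAt ι' β.1 s v) ∧ ∃ (F : Type) (_ : Field F) (_ : NumberField F) (_ : Algebra F K₀), NumberField.IsTotallyReal F ∧ Module.finrank F K₀ = 2 ∧ ∃ (sF : Literature.NumberTheory.GaloisRepresentations.FramedGaloisRep F (PadicAlgCl p) 2) (χ : Field.absoluteGaloisGroup K₀ →* PadicAlgCl p), sF.toGaloisRep.IsIrreducible ∧ Summit.Langlands.Langlands.Theorems.MonodromyDichotomySymmetricPowerAnchor.IsPinnedGeometric F p sF ∧ ∀ g : Field.absoluteGaloisGroup K₀, Literature.NumberTheory.GaloisRepresentations.FramedRep.charpoly s g = (Literature.NumberTheory.GaloisRepresentations.FramedRep.charpoly (sF.restrictField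 K₀) g).scaleRoots (χ g)) → (∃ (hcpt₂ : Literature.NumberTheory.Automorphic.isCompact_glFiniteIntegralLevel 2 K₀) (π₀ β : Literature.NumberTheory.Automorphic.CuspidalAutomorphicRepData 2 K₀ hcpt₂), (∀ᶠ v : IsDedekindDomain.HeightOneSpectrum (NumberField.RingOfIntegers K₀) in Filter.cofinite, SatakeFrobCompatibleAt ι π₀.1 σ₀ v) ∧ Relation.ReflTransGen (fun π π' : Literature.NumberTheory.Automorphic.CuspidalAutomorphicRepData 2 K₀ hcpt₂ => ∃ (p : ℕ) (_ : Fact p.Prime) (ι' : PadicAlgCl p ≃+* ℂ) (T : Literature.NumberTheory.Automorphic.InfinityType K₀ 2) (s s' : Literature.NumberTheory.GaloisRepresentations.FramedGaloisRep K₀ (PadicAlgCl p) 2) (R R' : Literature.NumberTheory.GaloisRepresentations.FramedGaloisRep K₀ (PadicAlgCl p) n) (τ : Field.absoluteGaloisGroup K₀ →* Matrix.GeneralLinearGroup (Fin n) (Literature.NumberTheory.GaloisRepresentations.padicAlgClResidueField p)), n ^ 2 < p ∧ Algebra.IsUnramifiedIn (NumberField.RingOfIntegers K₀) (Ideal.span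 {(p : ℤ)}) ∧ (∀ v : IsDedekindDomain.HeightOneSpectrum (NumberField.RingOfIntegers K₀), ((p : ℕ) : NumberField.RingOfIntegers K₀) ∈ v.asIdeal → π.1.IsUnramifiedAt v ∧ π'.1.IsUnramifiedAt v) ∧ π.1.HasInfinityType T ∧ π'.1.HasInfinityType T ∧ T.IsLAlgebraic ∧ T.IsRegular ∧ (∀ e : K₀ →+* ℂ, ∀ w₁ ∈ T e, ∀ w₂ ∈ T e, ((n : ℝ) - 1) * (‖w₁.a - w₂.a‖ + ‖w₁.b - w₂.b‖ + 2) + 2 * n < (p : ℝ)) ∧ (∀ᶠ v : IsDedekindDomain.HeightOneSpectrum (NumberField.RingOfIntegers K₀) in Filter.cofinite, SatakeFrobCompatibleAt ι' π.1 s v) ∧ (∀ᶠ v : IsDedekindDomain.HeightOneSpectrum (NumberField.RingOfIntegers K₀) in Filter.cofinite, SatakeFrobCompatibleAt ι' π'.1 s' v) ∧ Summit.Langlands.Langlands.Theorems.MonodromyDichotomySymmetricPowerAnchor.IsSymShadow K₀ p n R s ∧ Summit.Langlands.Langlands.Theorems.MonodromyDichotomySymmetricPowerAnchor.IsSymShadow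 K₀ p n R' s' ∧ R.IsResidualRepOf (RingHom.id _) τ ∧ R'.IsResidualRepOf (RingHom.id _) τ ∧ Literature.NumberTheory.GaloisRepresentations.IsAbsIrreducible τ ∧ Literature.NumberTheory.GaloisRepresentations.IsDecomposedGeneric τ ∧ Literature.NumberTheory.GaloisRepresentations.IsAbsIrreducible (τ.comp (Literature.NumberTheory.GaloisRepresentations.absGaloisGroupAdjoinRootsOfUnity K₀ p).subtype) ∧ Literature.NumberTheory.GaloisRepresentations.Subgroup.IsEnormous ((Literature.NumberTheory.GaloisRepresentations.absGaloisGroupAdjoinRootsOfUnity K₀ p).map τ) ∧ ∃ g₀ : Field.absoluteGaloisGroup K₀, g₀ ∉ Literature.NumberTheory.GaloisRepresentations.absGaloisGroupAdjoinRootsOfUnity K₀ p ∧ ∃ c : Literature.NumberTheory.GaloisRepresentations.padicAlgClResidueField p, ((τ g₀ : Matrix.GeneralLinearGroup (Fin n) (Literature.NumberTheory.GaloisRepresentations.padicAlgClResidueField p)) : Matrix (Fin n) (Fin n) (Literature.NumberTheory.GaloisRepresentations.padicAlgClResidueField p)) = c • (1 : Matrix (Fin n) (Fin n) (Literature.NumberTheory.GaloisRepresentations.padicAlgClResidueField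 p))) π₀ β ∧ ∃ (p : ℕ) (_ : Fact p.Prime) (ι' : PadicAlgCl p ≃+* ℂ) (s : Literature.NumberTheory.GaloisRepresentations.FramedGaloisRep K₀ (PadicAlgCl p) 2) (τ₂ : Field.absoluteGaloisGroup K₀ →* Matrix.GeneralLinearGroup (Fin 2) (Literature.NumberTheory.GaloisRepresentations.padicAlgClResidueField p)) (M : Type) (_ : Field M) (_ : NumberField M) (_ : Algebra K₀ M), n ^ 2 < p ∧ (∀ᶠ v : IsDedekindDomain.HeightOneSpectrum (NumberField.RingOfIntegers K₀) in Filter.cofinite, SatakeFrobCompatibleAt ι' β.1 s v) ∧ s.IsResidualRepOf (RingHom.id _) τ₂ ∧ 0 < Module.finrank K₀ M ∧ Module.finrank K₀ M ≤ 2 ∧ NumberField.IsCMField M ∧ ¬ Literature.NumberTheory.GaloisRepresentations.IsAbsIrreducible (τ₂.comp (Literature.NumberTheory.GaloisRepresentations.absGaloisRestrictMonoidHom K₀ M))) → ∃ P : Literature.NumberTheory.Automorphic.CuspidalAutomorphicRepData n K₀ hcpt, P.1.IsLAlgebraic ∧ ∀ᶠ v : IsDedekindDomain.HeightOneSpectrum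 (NumberField.RingOfIntegers K₀) in Filter.cofinite, ∃ a b : ℂ, σ₀.IsUnramifiedAt v ∧ σ₀.HasFrobCharpolyAt v (Literature.NumberTheory.Automorphic.arithFrobPolyOfSatake ι v.residueCard 1 ({a, b} : Multiset ℂ)) ∧ P.1.HasSatakeParamAt v (Literature.NumberTheory.Automorphic.symmPowerParams (n - 1) a b)

/-- piece C — SEED-ISOLATED `Sym^(n-1)` (DECLARED RESIDUAL: no admissible path to either seed type). -/
def SeedIsolatedSymPower : Prop :=
  ∀ (K₀ : Type) [Field K₀] [NumberField K₀] (n : ℕ) (hcpt : Literature.NumberTheory.Automorphic.isCompact_glFiniteIntegralLevel n K₀), 6 ≤ n → Summit.Langlands.Langlands.Theorems.MonodromyDichotomySymmetricPowerAnchor.RankIH n → NumberField.IsCMField K₀ → ∀ (ℓ : ℕ) [Fact ℓ.Prime] (ι : PadicAlgCl ℓ ≃+* ℂ) (σ₀ : Literature.NumberTheory.GaloisRepresentations.FramedGaloisRep K₀ (PadicAlgCl ℓ) 2), σ₀.toGaloisRep.IsIrreducible → Summit.Langlands.Langlands.Theorems.MonodromyDichotomySymmetricPowerAnchor.IsPinnedGeometric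 K₀ ℓ σ₀ → Summit.Langlands.Langlands.Theorems.MonodromyDichotomySymmetricPowerAnchor.IsLieIrreducible K₀ ℓ σ₀ → Summit.Langlands.Langlands.Theorems.MonodromyDichotomySymmetricPowerAnchor.HasCohomologicalPartner K₀ ℓ ι σ₀ → ¬ (∃ (hcpt₂ : Literature.NumberTheory.Automorphic.isCompact_glFiniteIntegralLevel 2 K₀) (π₀ β : Literature.NumberTheory.Automorphic.CuspidalAutomorphicRepData 2 K₀ hcpt₂), (∀ᶠ v : IsDedekindDomain.HeightOneSpectrum (NumberField.RingOfIntegers K₀) in Filter.cofinite, SatakeFrobCompatibleAt ι π₀.1 σ₀ v) ∧ Relation.ReflTransGen (fun π π' : Literature.NumberTheory.Automorphic.CuspidalAutomorphicRepData 2 K₀ hcpt₂ => ∃ (p : ℕ) (_ : Fact p.Prime) (ι' : PadicAlgCl p ≃+* ℂ) (T : Literature.NumberTheory.Automorphic.InfinityType K₀ 2) (s s' : Literature.NumberTheory.GaloisRepresentations.FramedGaloisRep K₀ (PadicAlgCl p) 2) (R R' : Literature.NumberTheory.GaloisRepresentations.FramedGaloisRep K₀ (PadicAlgCl p) n) (τ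 : Field.absoluteGaloisGroup K₀ →* Matrix.GeneralLinearGroup (Fin n) (Literature.NumberTheory.GaloisRepresentations.padicAlgClResidueField p)), n ^ 2 < p ∧ Algebra.IsUnramifiedIn (NumberField.RingOfIntegers K₀) (Ideal.span {(p : ℤ)}) ∧ (∀ v : IsDedekindDomain.HeightOneSpectrum (NumberField.RingOfIntegers K₀), ((p : ℕ) : NumberField.RingOfIntegers K₀) ∈ v.asIdeal → π.1.IsUnramifiedAt v ∧ π'.1.IsUnramifiedAt v) ∧ π.1.HasInfinityType T ∧ π'.1.HasInfinityType T ∧ T.IsLAlgebraic ∧ T.IsRegular ∧ (∀ e : K₀ →+* ℂ, ∀ w₁ ∈ T e, ∀ w₂ ∈ T e, ((n : ℝ) - 1) * (‖w₁.a - w₂.a‖ + ‖w₁.b - w₂.b‖ + 2) + 2 * n < (p : ℝ)) ∧ (∀ᶠ v : IsDedekindDomain.HeightOneSpectrum (NumberField.RingOfIntegers K₀) in Filter.cofinite, SatakeFrobCompatibleAt ι' π.1 s v) ∧ (∀ᶠ v : IsDedekindDomain.HeightOneSpectrum (NumberField.RingOfIntegers K₀) in Filter.cofinite, SatakeFrobCompatibleAt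 ι' π'.1 s' v) ∧ Summit.Langlands.Langlands.Theorems.MonodromyDichotomySymmetricPowerAnchor.IsSymShadow K₀ p n R s ∧ Summit.Langlands.Langlands.Theorems.MonodromyDichotomySymmetricPowerAnchor.IsSymShadow K₀ p n R' s' ∧ R.IsResidualRepOf (RingHom.id _) τ ∧ R'.IsResidualRepOf (RingHom.id _) τ ∧ Literature.NumberTheory.GaloisRepresentations.IsAbsIrreducible τ ∧ Literature.NumberTheory.GaloisRepresentations.IsDecomposedGeneric τ ∧ Literature.NumberTheory.GaloisRepresentations.IsAbsIrreducible (τ.comp (Literature.NumberTheory.GaloisRepresentations.absGaloisGroupAdjoinRootsOfUnity K₀ p).subtype) ∧ Literature.NumberTheory.GaloisRepresentations.Subgroup.IsEnormous ((Literature.NumberTheory.GaloisRepresentations.absGaloisGroupAdjoinRootsOfUnity K₀ p).map τ) ∧ ∃ g₀ : Field.absoluteGaloisGroup K₀, g₀ ∉ Literature.NumberTheory.GaloisRepresentations.absGaloisGroupAdjoinRootsOfUnity K₀ p ∧ ∃ c : Literature.NumberTheory.GaloisRepresentations.padicAlgClResidueField p, ((τ g₀ : Matrix.GeneralLinearGroup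 (Fin n) (Literature.NumberTheory.GaloisRepresentations.padicAlgClResidueField p)) : Matrix (Fin n) (Fin n) (Literature.NumberTheory.GaloisRepresentations.padicAlgClResidueField p)) = c • (1 : Matrix (Fin n) (Fin n) (Literature.NumberTheory.GaloisRepresentations.padicAlgClResidueField p))) π₀ β ∧ ∃ (p : ℕ) (_ : Fact p.Prime) (ι' : PadicAlgCl p ≃+* ℂ) (s : Literature.NumberTheory.GaloisRepresentations.FramedGaloisRep K₀ (PadicAlgCl p) 2), (∀ᶠ v : IsDedekindDomain.HeightOneSpectrum (NumberField.RingOfIntegers K₀) in Filter.cofinite, SatakeFrobCompatibleAt ι' β.1 s v) ∧ ∃ (F : Type) (_ : Field F) (_ : NumberField F) (_ : Algebra F K₀), NumberField.IsTotallyReal F ∧ Module.finrank F K₀ = 2 ∧ ∃ (sF : Literature.NumberTheory.GaloisRepresentations.FramedGaloisRep F (PadicAlgCl p) 2) (χ : Field.absoluteGaloisGroup K₀ →* PadicAlgCl p), sF.toGaloisRep.IsIrreducible ∧ Summit.Langlands.Langlands.Theorems.MonodromyDichotomySymmetricPowerAnchor.IsPinnedGeometric F p sF ∧ ∀ g : Field.absoluteGaloisGroup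 K₀, Literature.NumberTheory.GaloisRepresentations.FramedRep.charpoly s g = (Literature.NumberTheory.GaloisRepresentations.FramedRep.charpoly (sF.restrictField K₀) g).scaleRoots (χ g)) → ¬ (∃ (hcpt₂ : Literature.NumberTheory.Automorphic.isCompact_glFiniteIntegralLevel 2 K₀) (π₀ β : Literature.NumberTheory.Automorphic.CuspidalAutomorphicRepData 2 K₀ hcpt₂), (∀ᶠ v : IsDedekindDomain.HeightOneSpectrum (NumberField.RingOfIntegers K₀) in Filter.cofinite, SatakeFrobCompatibleAt ι π₀.1 σ₀ v) ∧ Relation.ReflTransGen (fun π π' : Literature.NumberTheory.Automorphic.CuspidalAutomorphicRepData 2 K₀ hcpt₂ => ∃ (p : ℕ) (_ : Fact p.Prime) (ι' : PadicAlgCl p ≃+* ℂ) (T : Literature.NumberTheory.Automorphic.InfinityType K₀ 2) (s s' : Literature.NumberTheory.GaloisRepresentations.FramedGaloisRep K₀ (PadicAlgCl p) 2) (R R' : Literature.NumberTheory.GaloisRepresentations.FramedGaloisRep K₀ (PadicAlgCl p) n) (τ : Field.absoluteGaloisGroup K₀ →* Matrix.GeneralLinearGroup (Fin n) (Literature.NumberTheory.GaloisRepresentations.padicAlgClResidueField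 p)), n ^ 2 < p ∧ Algebra.IsUnramifiedIn (NumberField.RingOfIntegers K₀) (Ideal.span {(p : ℤ)}) ∧ (∀ v : IsDedekindDomain.HeightOneSpectrum (NumberField.RingOfIntegers K₀), ((p : ℕ) : NumberField.RingOfIntegers K₀) ∈ v.asIdeal → π.1.IsUnramifiedAt v ∧ π'.1.IsUnramifiedAt v) ∧ π.1.HasInfinityType T ∧ π'.1.HasInfinityType T ∧ T.IsLAlgebraic ∧ T.IsRegular ∧ (∀ e : K₀ →+* ℂ, ∀ w₁ ∈ T e, ∀ w₂ ∈ T e, ((n : ℝ) - 1) * (‖w₁.a - w₂.a‖ + ‖w₁.b - w₂.b‖ + 2) + 2 * n < (p : ℝ)) ∧ (∀ᶠ v : IsDedekindDomain.HeightOneSpectrum (NumberField.RingOfIntegers K₀) in Filter.cofinite, SatakeFrobCompatibleAt ι' π.1 s v) ∧ (∀ᶠ v : IsDedekindDomain.HeightOneSpectrum (NumberField.RingOfIntegers K₀) in Filter.cofinite, SatakeFrobCompatibleAt ι' π'.1 s' v) ∧ Summit.Langlands.Langlands.Theorems.MonodromyDichotomySymmetricPowerAnchor.IsSymShadow K₀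 p n R s ∧ Summit.Langlands.Langlands.Theorems.MonodromyDichotomySymmetricPowerAnchor.IsSymShadow K₀ p n R' s' ∧ R.IsResidualRepOf (RingHom.id _) τ ∧ R'.IsResidualRepOf (RingHom.id _) τ ∧ Literature.NumberTheory.GaloisRepresentations.IsAbsIrreducible τ ∧ Literature.NumberTheory.GaloisRepresentations.IsDecomposedGeneric τ ∧ Literature.NumberTheory.GaloisRepresentations.IsAbsIrreducible (τ.comp (Literature.NumberTheory.GaloisRepresentations.absGaloisGroupAdjoinRootsOfUnity K₀ p).subtype) ∧ Literature.NumberTheory.GaloisRepresentations.Subgroup.IsEnormous ((Literature.NumberTheory.GaloisRepresentations.absGaloisGroupAdjoinRootsOfUnity K₀ p).map τ) ∧ ∃ g₀ : Field.absoluteGaloisGroup K₀, g₀ ∉ Literature.NumberTheory.GaloisRepresentations.absGaloisGroupAdjoinRootsOfUnity K₀ p ∧ ∃ c : Literature.NumberTheory.GaloisRepresentations.padicAlgClResidueField p, ((τ g₀ : Matrix.GeneralLinearGroup (Fin n) (Literature.NumberTheory.GaloisRepresentations.padicAlgClResidueField p)) : Matrix (Fin n) (Fin n) (Literature.NumberTheory.GaloisRepresentations.padicAlgClResidueField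 p)) = c • (1 : Matrix (Fin n) (Fin n) (Literature.NumberTheory.GaloisRepresentations.padicAlgClResidueField p))) π₀ β ∧ ∃ (p : ℕ) (_ : Fact p.Prime) (ι' : PadicAlgCl p ≃+* ℂ) (s : Literature.NumberTheory.GaloisRepresentations.FramedGaloisRep K₀ (PadicAlgCl p) 2) (τ₂ : Field.absoluteGaloisGroup K₀ →* Matrix.GeneralLinearGroup (Fin 2) (Literature.NumberTheory.GaloisRepresentations.padicAlgClResidueField p)) (M : Type) (_ : Field M) (_ : NumberField M) (_ : Algebra K₀ M), n ^ 2 < p ∧ (∀ᶠ v : IsDedekindDomain.HeightOneSpectrum (NumberField.RingOfIntegers K₀) in Filter.cofinite, SatakeFrobCompatibleAt ι' β.1 s v) ∧ s.IsResidualRepOf (RingHom.id _) τ₂ ∧ 0 < Module.finrank K₀ M ∧ Module.finrank K₀ M ≤ 2 ∧ NumberField.IsCMField M ∧ ¬ Literature.NumberTheory.GaloisRepresentations.IsAbsIrreducible (τ₂.comp (Literature.NumberTheory.GaloisRepresentations.absGaloisRestrictMonoidHom K₀ M))) → ∃ P : Literature.NumberTheory.Automorphic.CuspidalAutomorphicRepData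 n K₀ hcpt, P.1.IsLAlgebraic ∧ ∀ᶠ v : IsDedekindDomain.HeightOneSpectrum (NumberField.RingOfIntegers K₀) in Filter.cofinite, ∃ a b : ℂ, σ₀.IsUnramifiedAt v ∧ σ₀.HasFrobCharpolyAt v (Literature.NumberTheory.Automorphic.arithFrobPolyOfSatake ι v.residueCard 1 ({a, b} : Multiset ℂ)) ∧ P.1.HasSatakeParamAt v (Literature.NumberTheory.Automorphic.symmPowerParams (n - 1) a b)

/-- FRAME — SPF ⟹ Langlands (certified from the host route's other items: `frame_of_host`). -/
def SeedReachFrame : Prop :=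
  (∀ (K₀ : Type) [Field K₀] [NumberField K₀] (n : ℕ) (hcpt : Literature.NumberTheory.Automorphic.isCompact_glFiniteIntegralLevel n K₀), 6 ≤ n → Summit.Langlands.Langlands.Theorems.MonodromyDichotomySymmetricPowerAnchor.RankIH n → NumberField.IsCMField K₀ → ∀ (ℓ : ℕ) [Fact ℓ.Prime] (ι : PadicAlgCl ℓ ≃+* ℂ) (σ₀ : Literature.NumberTheory.GaloisRepresentations.FramedGaloisRep K₀ (PadicAlgCl ℓ) 2), σ₀.toGaloisRep.IsIrreducible → Summit.Langlands.Langlands.Theorems.MonodromyDichotomySymmetricPowerAnchor.IsPinnedGeometric K₀ ℓ σ₀ → Summit.Langlands.Langlands.Theorems.MonodromyDichotomySymmetricPowerAnchor.IsLieIrreducible K₀ ℓ σ₀ → Summit.Langlands.Langlands.Theorems.MonodromyDichotomySymmetricPowerAnchor.HasCohomologicalPartner K₀ ℓ ι σ₀ → ∃ P : Literature.NumberTheory.Automorphic.CuspidalAutomorphicRepData n K₀ hcpt, P.1.IsLAlgebraic ∧ ∀ᶠ v : IsDedekindDomain.HeightOneSpectrum (NumberField.RingOfIntegers K₀) in Filter.cofinite,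 ∃ a b : ℂ, σ₀.IsUnramifiedAt v ∧ σ₀.HasFrobCharpolyAt v (Literature.NumberTheory.Automorphic.arithFrobPolyOfSatake ι v.residueCard 1 ({a, b} : Multiset ℂ)) ∧ P.1.HasSatakeParamAt v (Literature.NumberTheory.Automorphic.symmPowerParams (n - 1) a b)) → _root_.Langlands

/-- print antecedent AVX — the `Sym^(n-1)`-AVATAR EXISTS: an irreducible pinned-geometric Lie-irreducible `σ₀ : Γ_(K₀) → GL₂(ℚ̄_ℓ)`
has an irreducible pinned-geometric Lie-irreducible `Sym^(n-1)`-shadow `ρ₀` (namely `Sym^(n-1) σ₀`; folklore: Zariski closure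
`⊇ SL₂`, tensor-closure of de Rham). Used ONLY in the certificates `spf_of_fc` / `*_of_fc` / `*_of_langlands`, never in `closes`. -/
def SymPowerAvatarExists : Prop :=
  ∀ (K₀ : Type) [Field K₀] [NumberField K₀] (n : ℕ), 2 ≤ n → ∀ (ℓ : ℕ) [Fact ℓ.Prime] (σ₀ : Literature.NumberTheory.GaloisRepresentations.FramedGaloisRep K₀ (PadicAlgCl ℓ) 2),
    σ₀.toGaloisRep.IsIrreducible → IsPinnedGeometric K₀ ℓ σ₀ → IsLieIrreducible K₀ ℓ σ₀ →
    ∃ ρ₀ : Literature.NumberTheory.GaloisRepresentations.FramedGaloisRep K₀ (PadicAlgCl ℓ) n,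
      ρ₀.toGaloisRep.IsIrreducible ∧ IsPinnedGeometric K₀ ℓ ρ₀ ∧ IsLieIrreducible K₀ ℓ ρ₀ ∧ IsSymShadow K₀ ℓ n ρ₀ σ₀

/-! ## §3 Vocabulary bridges (`Iff.rfl`): the route texts ARE the vocabulary forms -/

/-- SPF is literally CTX → `IsSymWeaklyAutomorphic` (the route text unfolds to the vocabulary form). -/
theorem spf_iff : SymPowerFunctoriality ↔
    ∀ (K₀ : Type) [Field K₀] [NumberField K₀] (n : ℕ) (hcpt : Literature.NumberTheory.Automorphic.isCompact_glFiniteIntegralLevel n K₀), 6 ≤ n → Summit.Langlands.Langlands.Theorems.MonodromyDichotomySymmetricPowerAnchor.RankIH n → NumberField.IsCMField K₀ → ∀ (ℓ : ℕ) [Fact ℓ.Prime] (ι : PadicAlgCl ℓ ≃+* ℂ) (σ₀ : Literature.NumberTheory.GaloisRepresentations.FramedGaloisRep K₀ (PadicAlgCl ℓ) 2), σ₀.toGaloisRep.IsIrreducible → Summit.Langlands.Langlands.Theorems.MonodromyDichotomySymmetricPowerAnchor.IsPinnedGeometric K₀ ℓ σ₀ → Summit.Langlands.Langlands.Theorems.MonodromyDichotomySymmetricPowerAnchor.IsLieIrreducible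 K₀ ℓ σ₀ → Summit.Langlands.Langlands.Theorems.MonodromyDichotomySymmetricPowerAnchor.HasCohomologicalPartner K₀ ℓ ι σ₀ → IsSymWeaklyAutomorphic K₀ n hcpt ℓ ι σ₀ := Iff.rfl

/-- A is literally CTX → `BCReachable` → `IsSymWeaklyAutomorphic`. -/
theorem a_iff : BaseChangeSeededSymPower ↔
    ∀ (K₀ : Type) [Field K₀] [NumberField K₀] (n : ℕ) (hcpt : Literature.NumberTheory.Automorphic.isCompact_glFiniteIntegralLevel n K₀), 6 ≤ n → Summit.Langlands.Langlands.Theorems.MonodromyDichotomySymmetricPowerAnchor.RankIH n → NumberField.IsCMField K₀ → ∀ (ℓ : ℕ) [Fact ℓ.Prime] (ι : PadicAlgCl ℓ ≃+* ℂ) (σ₀ : Literature.NumberTheory.GaloisRepresentations.FramedGaloisRep K₀ (PadicAlgCl ℓ) 2), σ₀.toGaloisRep.IsIrreducible → Summit.Langlands.Langlands.Theorems.MonodromyDichotomySymmetricPowerAnchor.IsPinnedGeometric K₀ ℓ σ₀ → Summit.Langlands.Langlands.Theorems.MonodromyDichotomySymmetricPowerAnchor.IsLieIrreducible K₀ ℓ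 σ₀ → Summit.Langlands.Langlands.Theorems.MonodromyDichotomySymmetricPowerAnchor.HasCohomologicalPartner K₀ ℓ ι σ₀ → BCReachable K₀ n ℓ ι σ₀ → IsSymWeaklyAutomorphic K₀ n hcpt ℓ ι σ₀ := Iff.rfl

/-- B is literally CTX → ¬`BCReachable` → `ThetaReachable` → `IsSymWeaklyAutomorphic`. -/
theorem b_iff : ThetaSeededSymPower ↔
    ∀ (K₀ : Type) [Field K₀] [NumberField K₀] (n : ℕ) (hcpt : Literature.NumberTheory.Automorphic.isCompact_glFiniteIntegralLevel n K₀), 6 ≤ n → Summit.Langlands.Langlands.Theorems.MonodromyDichotomySymmetricPowerAnchor.RankIH n → NumberField.IsCMField K₀ → ∀ (ℓ : ℕ) [Fact ℓ.Prime] (ι : PadicAlgCl ℓ ≃+* ℂ) (σ₀ : Literature.NumberTheory.GaloisRepresentations.FramedGaloisRep K₀ (PadicAlgCl ℓ) 2), σ₀.toGaloisRep.IsIrreducible → Summit.Langlands.Langlands.Theorems.MonodromyDichotomySymmetricPowerAnchor.IsPinnedGeometric K₀ ℓ σ₀ → Summit.Langlands.Langlands.Theorems.MonodromyDichotomySymmetricPowerAnchor.IsLieIrreducible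 K₀ ℓ σ₀ → Summit.Langlands.Langlands.Theorems.MonodromyDichotomySymmetricPowerAnchor.HasCohomologicalPartner K₀ ℓ ι σ₀ → ¬ BCReachable K₀ n ℓ ι σ₀ → ThetaReachable K₀ n ℓ ι σ₀ → IsSymWeaklyAutomorphic K₀ n hcpt ℓ ι σ₀ := Iff.rfl

/-- C is literally CTX → ¬`BCReachable` → ¬`ThetaReachable` → `IsSymWeaklyAutomorphic`. -/
theorem c_iff : SeedIsolatedSymPower ↔
    ∀ (K₀ : Type) [Field K₀] [NumberField K₀] (n : ℕ) (hcpt : Literature.NumberTheory.Automorphic.isCompact_glFiniteIntegralLevel n K₀), 6 ≤ n → Summit.Langlands.Langlands.Theorems.MonodromyDichotomySymmetricPowerAnchor.RankIH n → NumberField.IsCMField K₀ → ∀ (ℓ : ℕ) [Fact ℓ.Prime] (ι : PadicAlgCl ℓ ≃+* ℂ) (σ₀ : Literature.NumberTheory.GaloisRepresentations.FramedGaloisRep K₀ (PadicAlgCl ℓ) 2), σ₀.toGaloisRep.IsIrreducible → Summit.Langlands.Langlands.Theorems.MonodromyDichotomySymmetricPowerAnchor.IsPinnedGeometric K₀ ℓ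 σ₀ → Summit.Langlands.Langlands.Theorems.MonodromyDichotomySymmetricPowerAnchor.IsLieIrreducible K₀ ℓ σ₀ → Summit.Langlands.Langlands.Theorems.MonodromyDichotomySymmetricPowerAnchor.HasCohomologicalPartner K₀ ℓ ι σ₀ → ¬ BCReachable K₀ n ℓ ι σ₀ → ¬ ThetaReachable K₀ n ℓ ι σ₀ → IsSymWeaklyAutomorphic K₀ n hcpt ℓ ι σ₀ := Iff.rfl

/-- FRAME″ is literally SPF → Langlands. -/
theorem frame_iff : SeedReachFrame ↔ (SymPowerFunctoriality → _root_.Langlands) := Iff.rfl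

/-- `BCReachable` unfolds to: a compatible cuspidal π₀ on GL₂ joined by an admissible chain to a base-change form. -/
theorem bcReachable_iff (K₀ : Type) [Field K₀] [NumberField K₀] (n ℓ : ℕ) [Fact ℓ.Prime] (ι : PadicAlgCl ℓ ≃+* ℂ)
    (σ₀ : Literature.NumberTheory.GaloisRepresentations.FramedGaloisRep K₀ (PadicAlgCl ℓ) 2) :
    BCReachable K₀ n ℓ ι σ₀ ↔ ∃ (hcpt₂ : Literature.NumberTheory.Automorphic.isCompact_glFiniteIntegralLevel 2 K₀) (π₀ β : Literature.NumberTheory.Automorphic.CuspidalAutomorphicRepData 2 K₀ hcpt₂),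
      (∀ᶠ v : IsDedekindDomain.HeightOneSpectrum (NumberField.RingOfIntegers K₀) in Filter.cofinite, SatakeFrobCompatibleAt ι π₀.1 σ₀ v) ∧
      Relation.ReflTransGen (AdmissibleSymCongruence K₀ n hcpt₂) π₀ β ∧ IsBaseChangeForm K₀ hcpt₂ β := Iff.rfl

/-- `ThetaReachable` unfolds to: a compatible cuspidal π₀ on GL₂ joined by an admissible chain to an Eisenstein/theta form. -/
theorem thetaReachable_iff (K₀ : Type) [Field K₀] [NumberField K₀] (n ℓ : ℕ) [Fact ℓ.Prime] (ι : PadicAlgCl ℓ ≃+* ℂ)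
    (σ₀ : Literature.NumberTheory.GaloisRepresentations.FramedGaloisRep K₀ (PadicAlgCl ℓ) 2) :
    ThetaReachable K₀ n ℓ ι σ₀ ↔ ∃ (hcpt₂ : Literature.NumberTheory.Automorphic.isCompact_glFiniteIntegralLevel 2 K₀) (π₀ β : Literature.NumberTheory.Automorphic.CuspidalAutomorphicRepData 2 K₀ hcpt₂),
      (∀ᶠ v : IsDedekindDomain.HeightOneSpectrum (NumberField.RingOfIntegers K₀) in Filter.cofinite, SatakeFrobCompatibleAt ι π₀.1 σ₀ v) ∧
      Relation.ReflTransGen (AdmissibleSymCongruence K₀ n hcpt₂) π₀ β ∧ IsThetaForm K₀ n hcpt₂ β := Iff.rfl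

end Summit.Langlands.Langlands.Theorems.SeedReach
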